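import Literature.NumberTheory.Automorphic.MeyerCompactTest
import Mathlib.NumberTheory.LSeries.Nonvanishing
import Mathlib.Analysis.SpecialFunctions.Gamma.Deligne
import Mathlib.Analysis.Complex.CauchyIntegral
import Mathlib.Analysis.Analytic.Order
import Mathlib.Analysis.Calculus.BumpFunction.Basic
import Mathlib.Analysis.Calculus.BumpFunction.InnerProduct
import HarnessLib

/-!
# Meyer's global difference representation — proofs, `K = ℚ`: orders of vanishing of `Λ`, the
# entire avatar `z(1-z)ζ(z)`, and a test function with non-vanishing Mellin transform

Topic `NumberTheory/Automorphic`; namespace `Literature.NumberTheory.Automorphic.Meyer`. Sibling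
PROOF file for Step D/F of the plan for `Meyer.spectralRealisation_rat` [Meyer2005, Thm. 5.11]
(bookkeeping around the completed zeta function `Λ = completedRiemannZeta`):

* `zetaEntire z = z (1 - z) Λ₀(z) - 1` (`= z(1-z)Λ(z)` off `{0, 1}`, `zetaEntire_eq`) and
  `zetaTwo z = zetaEntire z · Γ_ℝ(z)⁻¹` (`= z(1-z)ζ(z)` off `{0, 1}`, `zetaTwo_eq`) are ENTIRE;
* `analyticOrderAt_zetaEntire` — `ord_s zetaEntire = ord_s Λ` for `s ∉ {0, 1}`;
  `analyticOrderAt_zetaTwo` — `ord_s zetaTwo = ord_s Λ` for `0 < Re s`, `s ≠ 1`;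
* `analyticOrderAt_completedZeta_eq_zero` — `ord_s Λ = 0` unless `0 < Re s < 1` (`s ∉ {0,1}`):
  non-vanishing of `ζ` on `Re s ≥ 1` (Mathlib) and the functional equation;
* `eqOn_of_eqOn_one_lt_re` — identity theorem on the right half-plane;
* **`analyticOrderAt_ge_of_eq_zeta_mul`** — if an entire `F` equals `ζ · Q` on `Re z > 1` with `Q`
  holomorphic on `Re z > 0`, then `ord_s Λ ≤ ord_s F` for `0 < Re s < 1` (DIVISIBILITY, read in
  orders of vanishing);
* `bumpTest`, `testG₀ = D_1 bumpTest` — a compact test function with `∫ testG₀ = 0` whose Mellin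
  transform is not identically zero near any point (`analyticOrderAt_mellin_testG₀_ne_top`).

Everything is proved; the definitions are `zetaEntire`, `zetaTwo`, `bumpTest`, `testG₀`.

## References

* R. Meyer, *On a representation of the idele class group related to primes and zeros of
  L-functions*, Duke Math. J. 127 (2005) = arXiv:math/0311468, Thm. 5.11, §5.7 [Meyer2005].
-/

noncomputable section

open MeasureTheory Set Filter Complex
open scoped Topology

namespace Literature.NumberTheory.Automorphic.Meyer

/-! ### The entire avatars of `Λ` and `ζ` -/

/-- `z(1-z)Λ₀(z) - 1`, an entire function equal to `z(1-z)Λ(z)` off `{0,1}`. [folklore] -/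
def zetaEntire (z : ℂ) : ℂ := z * (1 - z) * completedRiemannZeta₀ z - 1

/-- `zetaEntire` is entire. [folklore] -/
theorem differentiable_zetaEntire : Differentiable ℂ zetaEntire := by
  unfold zetaEntire
  exact ((differentiable_id.mul ((differentiable_const (1 : ℂ)).sub differentiable_id)).mul
    differentiable_completedZeta₀).sub_const 1

/-- `zetaEntire z = z(1-z)Λ(z)` for `z ∉ {0, 1}`. [folklore] -/
theorem zetaEntire_eq {z : ℂ} (h0 : z ≠ 0) (h1 : z ≠ 1) : zetaEntire z = z * (1 - z) * completedRiemannZeta z := by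
  rw [zetaEntire, completedRiemannZeta_eq]
  have h1' : (1 - z) ≠ 0 := sub_ne_zero.mpr (Ne.symm h1)
  field_simp
  ring

/-- `zetaTwo z = zetaEntire z / Γ_ℝ(z)`, an entire function equal to `z(1-z)ζ(z)` off `{0,1}`. [folklore] -/
def zetaTwo (z : ℂ) : ℂ := zetaEntire z * (Gammaℝ z)⁻¹

/-- `zetaTwo` is entire. [folklore] -/
theorem differentiable_zetaTwo : Differentiable ℂ zetaTwo :=
  differentiable_zetaEntire.mul differentiable_Gammaℝ_inv

/-- `zetaTwo z = z(1-z)ζ(z)` for `z ∉ {0, 1}`. [folklore] -/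
theorem zetaTwo_eq {z : ℂ} (h0 : z ≠ 0) (h1 : z ≠ 1) : zetaTwo z = z * (1 - z) * riemannZeta z := by
  rw [zetaTwo, zetaEntire_eq h0 h1, riemannZeta_def_of_ne_zero h0, div_eq_mul_inv]
  ring

/-! ### Orders of vanishing -/

/-- `ord_s (z(1-z)) = 0` for `s ∉ {0,1}`. [folklore] -/
theorem analyticOrderAt_mul_one_sub {s : ℂ} (h0 : s ≠ 0) (h1 : s ≠ 1) :
    analyticOrderAt (fun z : ℂ => z * (1 - z)) s = 0 := by
  rw [AnalyticAt.analyticOrderAt_eq_zero (by fun_prop)]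
  exact mul_ne_zero h0 (sub_ne_zero.mpr (Ne.symm h1))

/-- **`ord_s zetaEntire = ord_s Λ`** for `s ∉ {0, 1}`. [folklore] -/
theorem analyticOrderAt_zetaEntire {s : ℂ} (h0 : s ≠ 0) (h1 : s ≠ 1) :
    analyticOrderAt zetaEntire s = analyticOrderAt completedRiemannZeta s := by
  have hev : zetaEntire =ᶠ[𝓝 s] (fun z : ℂ => z * (1 - z)) * completedRiemannZeta := by
    have hopen : IsOpen ({0, 1}ᶜ : Set ℂ) := (Set.toFinite _).isClosed.isOpen_compl
    filter_upwards [hopen.mem_nhds (by simp [h0, h1])] with z hz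
    simp only [Set.mem_compl_iff, Set.mem_insert_iff, Set.mem_singleton_iff, not_or] at hz
    rw [Pi.mul_apply, zetaEntire_eq hz.1 hz.2]
  have hΛ : AnalyticAt ℂ completedRiemannZeta s := by
    refine Complex.analyticAt_iff_eventually_differentiableAt.mpr ?_
    have hopen : IsOpen ({0, 1}ᶜ : Set ℂ) := (Set.toFinite _).isClosed.isOpen_compl
    filter_upwards [hopen.mem_nhds (by simp [h0, h1])] with z hz
    simp only [Set.mem_compl_iff, Set.mem_insert_iff, Set.mem_singleton_iff, not_or] at hz
    exact differentiableAt_completedZeta hz.1 hz.2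
  rw [analyticOrderAt_congr hev, analyticOrderAt_mul (by fun_prop) hΛ, analyticOrderAt_mul_one_sub h0 h1, zero_add]

/-- **`ord_s zetaTwo = ord_s Λ`** for `0 < Re s`, `s ≠ 1`. [folklore] -/
theorem analyticOrderAt_zetaTwo {s : ℂ} (hs : 0 < s.re) (h1 : s ≠ 1) :
    analyticOrderAt zetaTwo s = analyticOrderAt completedRiemannZeta s := by
  have h0 : s ≠ 0 := by rintro rfl; simp at hs
  have hG : analyticOrderAt (fun z : ℂ => (Gammaℝ z)⁻¹) s = 0 := by
    rw [AnalyticAt.analyticOrderAt_eq_zero (differentiable_Gammaℝ_inv.analyticAt s)]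
    exact inv_ne_zero (Gammaℝ_ne_zero_of_re_pos hs)
  rw [show zetaTwo = zetaEntire * fun z : ℂ => (Gammaℝ z)⁻¹ from rfl,
    analyticOrderAt_mul (differentiable_zetaEntire.analyticAt s) (differentiable_Gammaℝ_inv.analyticAt s), hG,
    add_zero, analyticOrderAt_zetaEntire h0 h1]

/-- **`Λ(s) ≠ 0` off the critical strip**: for `s ∉ {0,1}` with `Re s ≤ 0` or `1 ≤ Re s`.
[folklore] -/
theorem completedZeta_ne_zero_of_not_mem_strip {s : ℂ} (h0 : s ≠ 0) (h1 : s ≠ 1) (hs : s.re ≤ 0 ∨ 1 ≤ s.re) :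
    completedRiemannZeta s ≠ 0 := by
  -- reduce to `1 ≤ Re s` by the functional equation
  wlog hs1 : 1 ≤ s.re generalizing s with H
  · have hle : s.re ≤ 0 := by
      rcases hs with h | h
      · exact h
      · exact absurd h hs1
    have h := H (s := 1 - s) (sub_ne_zero.mpr (Ne.symm h1)) (by intro h; apply h0; linear_combination -h)
      (Or.inr (by simp; linarith)) (by simp; linarith)
    rwa [completedRiemannZeta_one_sub] at h
  have hζ : riemannZeta s ≠ 0 := riemannZeta_ne_zero_of_one_le_re hs1
  rw [riemannZeta_def_of_ne_zero h0] at hζ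
  intro hΛ
  exact hζ (by rw [hΛ, zero_div])

/-- `ord_s Λ = 0` off the critical strip (`s ∉ {0,1}`). [folklore] -/
theorem analyticOrderAt_completedZeta_eq_zero {s : ℂ} (h0 : s ≠ 0) (h1 : s ≠ 1) (hs : s.re ≤ 0 ∨ 1 ≤ s.re) :
    analyticOrderAt completedRiemannZeta s = 0 := by
  have hΛ : AnalyticAt ℂ completedRiemannZeta s := by
    refine Complex.analyticAt_iff_eventually_differentiableAt.mpr ?_
    have hopen : IsOpen ({0, 1}ᶜ : Set ℂ) := (Set.toFinite _).isClosed.isOpen_compl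
    filter_upwards [hopen.mem_nhds (by simp [h0, h1])] with z hz
    simp only [Set.mem_compl_iff, Set.mem_insert_iff, Set.mem_singleton_iff, not_or] at hz
    exact differentiableAt_completedZeta hz.1 hz.2
  rw [hΛ.analyticOrderAt_eq_zero]
  exact completedZeta_ne_zero_of_not_mem_strip h0 h1 hs

/-! ### Identity theorem on the right half-plane and divisibility in orders -/

/-- Two functions holomorphic on `Re z > 0` which agree on `Re z > 1` agree on `Re z > 0`. [folklore] -/
theorem eqOn_of_eqOn_one_lt_re {A B : ℂ → ℂ} (hA : DifferentiableOn ℂ A {z : ℂ | 0 < z.re})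
    (hB : DifferentiableOn ℂ B {z : ℂ | 0 < z.re}) (h : ∀ z : ℂ, 1 < z.re → A z = B z) :
    EqOn A B {z : ℂ | 0 < z.re} := by
  have hopen : IsOpen {z : ℂ | 0 < z.re} := isOpen_lt continuous_const Complex.continuous_re
  have hconv : Convex ℝ {z : ℂ | 0 < z.re} := convex_halfSpace_re_gt 0
  have hA' : AnalyticOnNhd ℂ A {z : ℂ | 0 < z.re} := hA.analyticOnNhd hopen
  have hB' : AnalyticOnNhd ℂ B {z : ℂ | 0 < z.re} := hB.analyticOnNhd hopen
  have hev : A =ᶠ[𝓝 (2 : ℂ)] B := by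
    have hopen1 : IsOpen {z : ℂ | 1 < z.re} := isOpen_lt continuous_const Complex.continuous_re
    filter_upwards [hopen1.mem_nhds (show (2 : ℂ) ∈ {z : ℂ | 1 < z.re} by simp)] with w hw
    exact h w hw
  exact hA'.eqOn_of_preconnected_of_eventuallyEq hB' hconv.isPreconnected (show (2 : ℂ) ∈ {z : ℂ | 0 < z.re} by simp) hev

/-- **DIVISIBILITY in orders of vanishing.** If `F` is entire and `F = ζ · Q` on `Re z > 1` with
`Q` holomorphic on `Re z > 0`, then `ord_s Λ ≤ ord_s F` at every `s` with `0 < Re s < 1`.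
[cite: Meyer2005, Lemma 5.3] -/
theorem analyticOrderAt_ge_of_eq_zeta_mul {F Q : ℂ → ℂ} (hF : Differentiable ℂ F)
    (hQ : DifferentiableOn ℂ Q {z : ℂ | 0 < z.re}) (h : ∀ z : ℂ, 1 < z.re → F z = riemannZeta z * Q z)
    {s : ℂ} (hs0 : 0 < s.re) (hs1 : s.re < 1) :
    analyticOrderAt completedRiemannZeta s ≤ analyticOrderAt F s := by
  have h0 : s ≠ 0 := by rintro rfl; simp at hs0
  have h1 : s ≠ 1 := by rintro rfl; simp at hs1
  -- `z(1-z) F = zetaTwo · Q` on `Re z > 0`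
  set A : ℂ → ℂ := fun z => z * (1 - z) * F z with hA
  set B : ℂ → ℂ := fun z => zetaTwo z * Q z with hB
  have hopen : IsOpen {z : ℂ | 0 < z.re} := isOpen_lt continuous_const Complex.continuous_re
  have hAd : DifferentiableOn ℂ A {z : ℂ | 0 < z.re} := by
    refine Differentiable.differentiableOn ?_
    exact (differentiable_id.mul ((differentiable_const (1 : ℂ)).sub differentiable_id)).mul hF
  have hBd : DifferentiableOn ℂ B {z : ℂ | 0 < z.re} := differentiable_zetaTwo.differentiableOn.mul hQ
  have hAB : EqOn A B {z : ℂ | 0 < z.re} := by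
    refine eqOn_of_eqOn_one_lt_re hAd hBd fun z hz => ?_
    have hz0 : z ≠ 0 := by rintro rfl; norm_num at hz
    have hz1 : z ≠ 1 := by rintro rfl; norm_num at hz
    simp only [hA, hB, h z hz, zetaTwo_eq hz0 hz1]
    ring
  -- orders at `s`
  have hsmem : s ∈ {z : ℂ | 0 < z.re} := hs0
  have hevAB : A =ᶠ[𝓝 s] B := by
    filter_upwards [hopen.mem_nhds hsmem] with z hz using hAB hz
  have hordA : analyticOrderAt A s = analyticOrderAt F s := by
    rw [show A = (fun z : ℂ => z * (1 - z)) * F from rfl, analyticOrderAt_mul (by fun_prop) (hF.analyticAt s),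
      analyticOrderAt_mul_one_sub h0 h1, zero_add]
  have hQan : AnalyticAt ℂ Q s := (hQ.analyticOnNhd hopen) s hsmem
  have hordB : analyticOrderAt B s = analyticOrderAt completedRiemannZeta s + analyticOrderAt Q s := by
    rw [show B = zetaTwo * Q from rfl, analyticOrderAt_mul (differentiable_zetaTwo.analyticAt s) hQan,
      analyticOrderAt_zetaTwo hs0 h1]
  rw [← hordA, analyticOrderAt_congr hevAB, hordB]
  exact le_self_add

/-! ### A compact test function with `∫ = 0` and non-trivial Mellin transform -/

/-- A smooth bump on `ℝ` supported in `[1, 2]`, equal to `1` on `[5/4, 7/4]`. [folklore] -/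
def bump : ContDiffBump (3 / 2 : ℝ) := ⟨1 / 4, 1 / 2, by norm_num, by norm_num⟩

/-- The bump as a complex-valued compact test function `bumpTest`. [folklore] -/
def bumpTest (t : ℝ) : ℂ := ((bump : ℝ → ℝ) t : ℂ)

/-- `bumpTest` is a compact test function. [folklore] -/
theorem isCompactTest_bumpTest : IsCompactTest bumpTest := by
  refine ⟨Complex.ofRealCLM.contDiff.comp bump.contDiff, 1, 2, one_pos, fun t ht => ?_, fun t ht => ?_⟩
  · have h : (bump : ℝ → ℝ) t = 0 := by
      apply bump.zero_of_le_dist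
      rw [Real.dist_eq, show (bump).rOut = 1 / 2 from rfl]
      rw [abs_of_nonpos (by linarith)]
      linarith
    simp [bumpTest, h]
  · have h : (bump : ℝ → ℝ) t = 0 := by
      apply bump.zero_of_le_dist
      rw [Real.dist_eq, show (bump).rOut = 1 / 2 from rfl]
      rw [abs_of_nonneg (by linarith)]
      linarith
    simp [bumpTest, h]

/-- **The test function `G₀ = D_1 (bump) = -t · bump' - bump`.** [cite: Meyer2005, §5.7] -/
def testG₀ : ℝ → ℂ := Ds 1 bumpTest

/-- `G₀` is a compact test function. [folklore] -/
theorem isCompactTest_testG₀ : IsCompactTest testG₀ := isCompactTest_Ds isCompactTest_bumpTest 1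

/-- `M(G₀)(z) = (z - 1) M(bump)(z)`. [folklore] -/
theorem mellin_testG₀ (z : ℂ) : mellin testG₀ z = (z - 1) * mellin bumpTest z :=
  isCompactTest_bumpTest.mellin_Ds 1 z

/-- **`∫ G₀ = 0`.** [folklore] -/
theorem integral_testG₀ : ∫ t : ℝ, testG₀ t = 0 := by
  rw [isCompactTest_testG₀.integral_eq_mellin_one, mellin_testG₀, sub_self, zero_mul]

/-- `M(bump)(2) ≠ 0`: it is the integral of the non-negative, not identically zero function
`t · bump(t)`. [folklore] -/
theorem mellin_bumpTest_two_ne_zero : mellin bumpTest 2 ≠ 0 := by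
  -- `M(bump)(2) = ∫₀^∞ t · bump(t) dt`, a positive real number
  have hreal : mellin bumpTest 2 = ((∫ t in Ioi (0 : ℝ), t * (bump : ℝ → ℝ) t : ℝ) : ℂ) := by
    rw [mellin, ← integral_complex_ofReal]
    refine setIntegral_congr_fun measurableSet_Ioi fun t ht => ?_
    rw [show (2 : ℂ) - 1 = 1 by norm_num, cpow_one, bumpTest, smul_eq_mul, Complex.ofReal_mul]
  rw [hreal, Complex.ofReal_ne_zero]
  have hcont : Continuous fun t : ℝ => t * (bump : ℝ → ℝ) t := continuous_id.mul bump.continuous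
  have hnn : ∀ t, 0 ≤ t * (bump : ℝ → ℝ) t ∨ t ≤ 0 := fun t => by
    by_cases ht : 0 ≤ t
    · exact Or.inl (mul_nonneg ht bump.nonneg)
    · exact Or.inr (le_of_lt (not_le.mp ht))
  have hpos : 0 < ∫ t in Ioi (0 : ℝ), t * (bump : ℝ → ℝ) t := by
    have hsupp : HasCompactSupport fun t : ℝ => t * (bump : ℝ → ℝ) t := bump.hasCompactSupport.mul_left
    rw [integral_pos_iff_support_of_nonneg_ae ?_ ((hcont.integrable_of_hasCompactSupport hsupp).integrableOn)]
    · -- the support meets `(0, ∞)` in a set of positive measure: it contains `(5/4, 7/4)`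
      have hsub : Ioo (5 / 4 : ℝ) (7 / 4) ⊆ (Function.support fun t : ℝ => t * (bump : ℝ → ℝ) t) ∩ Ioi 0 := by
        intro t ht
        refine ⟨?_, show (0 : ℝ) < t by linarith [ht.1]⟩
        rw [Function.mem_support]
        have hb : (bump : ℝ → ℝ) t = 1 := by
          apply bump.one_of_mem_closedBall
          rw [Metric.mem_closedBall, Real.dist_eq, show (bump).rIn = 1 / 4 from rfl, abs_le]
          constructor <;> linarith [ht.1, ht.2]
        rw [hb, mul_one]
        linarith [ht.1]
      rw [Measure.restrict_apply' measurableSet_Ioi]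
      calc (0 : ENNReal) < volume (Ioo (5 / 4 : ℝ) (7 / 4)) := by rw [Real.volume_Ioo]; norm_num
        _ ≤ volume ((Function.support fun t : ℝ => t * (bump : ℝ → ℝ) t) ∩ Ioi 0) := measure_mono hsub
    · filter_upwards [ae_restrict_mem measurableSet_Ioi] with t ht
      exact mul_nonneg (le_of_lt ht) bump.nonneg
  exact hpos.ne'

/-- `M(G₀)` is not identically zero: `M(G₀)(2) = M(bump)(2) ≠ 0`. [folklore] -/
theorem mellin_testG₀_two_ne_zero : mellin testG₀ 2 ≠ 0 := by
  rw [mellin_testG₀]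
  norm_num
  exact mellin_bumpTest_two_ne_zero

/-- **`ord_s M(G₀) < ∞` at every `s`**: an entire function vanishing identically near a point
vanishes everywhere. [folklore] -/
theorem analyticOrderAt_mellin_testG₀_ne_top (s : ℂ) : analyticOrderAt (mellin testG₀) s ≠ ⊤ := by
  intro htop
  rw [analyticOrderAt_eq_top] at htop
  have hana : AnalyticOnNhd ℂ (mellin testG₀) univ :=
    (isCompactTest_testG₀.differentiable_mellin.differentiableOn.analyticOnNhd isOpen_univ)
  have h := hana.eqOn_zero_of_preconnected_of_eventuallyEq_zero isPreconnected_univ (mem_univ s) htop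
  exact mellin_testG₀_two_ne_zero (h (mem_univ 2))

end Literature.NumberTheory.Automorphic.Meyer
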